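import Mathlib
import Literature.NumberTheory.LFunctions.Zhang2022.TypedSection10C
import Literature.NumberTheory.LFunctions.Zhang2022.Section10MainTerms
import Literature.NumberTheory.LFunctions.Zhang2022.Section10Theta1Evals
import Literature.NumberTheory.LFunctions.Zhang2022.Section10cExpandSplit
import Literature.NumberTheory.LFunctions.Zhang2022.Section10cGather1422
import HarnessLib

/-!
# Zhang (2022) §10c, discharged bookkeeping III: "Gathering the above results together" for
# `S_j(𝐚₁₂,𝐚₁₄)` (DAG node Z22:§10.u058) from the seven range claims, with its exact main term

Topic `Literature/NumberTheory/LFunctions/Zhang2022` (Landau–Siegel audit tree; verdict-neutral).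
Y. Zhang, *Discrete mean estimates and the Landau–Siegel zero*, arXiv:2211.02515v1 (2022)
[Zhang2022LandauSiegel], §10 pp. 58–61 — **an unrefereed manuscript under adjudication; this file
asserts nothing about its Theorems 1–2.** D-0069 campaign, discharge layer L3 (seat sz-d34).

What is PROVED here (kernel-checked implications between the typed CLAIM nodes of `TypedSection10C`
plus exact identities between the printed constants; no analytic number theory):

| DAG node | locator | theorem | content |
|---|---|---|---|
| `Z22:§10.u058` main term | p.61 | `gather1214_identity`, `gather1214_main_small` | `α⁻¹(lowInt1214 + midInt1214 + topInt1214) − (d′_{6j} + d_{6j})𝔞 = −(n_jπ/500)𝔞E_jB₁` EXACTLY, and this is `o(1)` (`≪_{c′} 𝓛⁻⁴`) |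
| `Z22:§10.u058` | p.61, tex L3111 | `gather1214_of_ranges` | the seven range claims of pp.60–61 ⊢ `Gather1214 c′`: "`α⁻¹S_j(𝐚₁₂,𝐚₁₄) = (d′_{6j} + d_{6j})𝔞 + o(1)`" |

With `Section10cExpandSplit` (u047/u048/u054/u055-split), `Section10cGather1422` (u051) and the
"by Proposition 7.1" consumers of `Section10Theta1Evals` (`Skeleton.eq1014_of_sj`, `eq1016_of_sj`;
composed into `Typed.Sec10C.Ded1014/Ded1016` by sz-d43's `Section10CDedEdges`), every bookkeeping step
of the sub-DAG of (10.14)/(10.16) is a theorem; what remains CLAIMED are Proposition 7.1 and the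
analytic range evaluations (shifted Lemmas 10.1/10.2, Lemmas 8.2–8.4, the §8 summation rule), which
enter as hypotheses. The one place where a tacit estimate is needed is the LOW range of `S_j(𝐚₁₂,𝐚₁₄)`: its
prefactor carries `β_{j+1}β_{j+2}log P`, equal to `−(11−6j+j²)πα` only up to the factor `1 + E_j`,
`E_j = O_{c′}(α𝓛) = O_{c′}(𝓛⁻⁸)` from the `c′α𝓛`-corrections of (2.13) (`betaJ_pair`,
`Section10cGather1422`); the resulting mismatch `(n_jπ/500)·𝔞·|E_j|·‖B₁‖` is `o(1)` because
`𝔞 ≪ 𝓛⁴` (the tree's `Skeleton.frakA_le_ell_pow_four`, `Section10Theta1Evals`, from `|L′(1,χ)| ≪ 𝓛²`)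
— `gather1214_main_small` makes this explicit.

## References

* Y. Zhang, arXiv:2211.02515v1 (2022), §10 pp. 58–61, (10.14)–(10.16); §2 (2.13), (2.31).
  [cite: Zhang2022LandauSiegel, §10 pp. 58–61]
-/

noncomputable section

open Complex Real ComplexConjugate
open Literature.NumberTheory.LFunctions.Zhang2022.Skeleton

namespace Literature.NumberTheory.LFunctions.Zhang2022.Typed.Sec10C

section D34Gather1214

/-- The middle-range integrand of `S_j(𝐚₁₂,𝐚₁₄)` split into three pieces.
[cite: Zhang2022LandauSiegel, §10 p. 61] -/
theorem midInt1214_pieces (j : ℕ) :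
    (∫ z in (0 : ℝ)..0.002,
      (conj iota3 * ffJ6 j z / 0.498 + conj iota4 * ffJ7 j (0.002 + z) / 0.5) *
        (-1 + yyJ1 j (0.502 - z)))
      = -(conj iota3 / 0.498) * (∫ z in (0 : ℝ)..0.002, ffJ6 j z)
        + -(conj iota4 / 0.5) * (∫ z in (0 : ℝ)..0.002, ffJ7 j (0.002 + z))
        + ∫ z in (0 : ℝ)..0.002,
            (conj iota3 * ffJ6 j z / 0.498 + conj iota4 * ffJ7 j (0.002 + z) / 0.5) *
              yyJ1 j (0.502 - z) := by
  rw [← intervalIntegral.integral_const_mul, ← intervalIntegral.integral_const_mul,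
    ← integral_add3 (by fun_prop) (by fun_prop) (by fun_prop)]
  exact intervalIntegral.integral_congr fun z _ => by ring

/-- The top-range integrand of `S_j(𝐚₁₂,𝐚₁₄)` split into two pieces.
[cite: Zhang2022LandauSiegel, §10 p. 61] -/
theorem topInt1214_pieces (j : ℕ) :
    (∫ z in (0 : ℝ)..0.002, ffJ7 j z * (1 + yyJ2 j (0.504 - z)))
      = (∫ z in (0 : ℝ)..0.002, ffJ7 j z)
        + ∫ z in (0 : ℝ)..0.002, ffJ7 j z * yyJ2 j (0.504 - z) := by
  rw [← integral_add2 (by fun_prop) (by fun_prop)]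
  exact intervalIntegral.integral_congr fun z _ => by ring

/-- **The main-term identity of "Gathering" for `S_j(𝐚₁₂,𝐚₁₄)`** (p. 61), EXACT with its error:
for `j = 1, 2, 3` and `log P > 0`,
`α⁻¹·(lowInt1214 + midInt1214 + topInt1214) − (d′_{6j} + d_{6j})𝔞 = −(n_jπ/500)·𝔞·E_j·B₁`
where `B₁ = ∫₀^{0.496}(ῑ₃𝔣𝔣_{j6}(0.002 + z)/0.498 + ῑ₄𝔣𝔣_{j7}(0.004 + z)/0.5)dz` and `E_j` is the
relative deviation of `β_{j+1}β_{j+2}` from `−n_jα²` (`betaJ_pair`): the middle and top ranges match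
`d′_{6j}` and the last three terms of `d_{6j}` on the nose, the low range matches the first term of
`d_{6j}` up to the factor `1 + E_j`. [cite: Zhang2022LandauSiegel, §10 p. 61] -/
theorem gather1214_identity (c' : ℝ) {D : ℕ} [NeZero D] (χ : DirichletCharacter ℂ D) {j : ℕ}
    (hj : j ∈ ({1, 2, 3} : Finset ℕ)) (hΛ : 0 < Real.log (bigP D)) :
    ∃ n : ℕ, ∃ E : ℝ, (n : ℝ) ≤ 6 ∧
      |E| ≤ 6 * |c' * alpha D * ell D| + 5 * (c' * alpha D * ell D) ^ 2 ∧
      (alpha D : ℂ)⁻¹ * (lowInt1214 c' χ j + midInt1214 χ j + topInt1214 χ j) -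
          (d6pJ j + d6J j) * frakA χ =
        -((((n : ℝ) * π / 500 : ℝ)) : ℂ) * (frakA χ : ℂ) * (E : ℂ) *
          ∫ z in (0 : ℝ)..0.496,
            (conj iota3 * ffJ6 j (0.002 + z) / 0.498 + conj iota4 * ffJ7 j (0.004 + z) / 0.5) := by
  obtain ⟨n, E, hd6, hn, hE, hprod⟩ := betaJ_pair c' D hj
  refine ⟨n, E, hn, hE, ?_⟩
  have hΛ0 : (Real.log (bigP D) : ℂ) ≠ 0 := by exact_mod_cast hΛ.ne'
  have hπ0 : (π : ℂ) ≠ 0 := by exact_mod_cast Real.pi_ne_zero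
  have hαinv : (alpha D : ℂ)⁻¹ = (Real.log (bigP D) : ℂ) / π := by
    rw [alpha, Complex.ofReal_div, inv_div]
  have hα : (alpha D : ℂ) = π / (Real.log (bigP D) : ℂ) := by
    rw [alpha, Complex.ofReal_div]
  have D7 : (∫ z in (0:ℝ)..0.002, (ffJ7 j z - ffJ7 j (0.002 + z)))
      = (∫ z in (0:ℝ)..0.002, ffJ7 j z) - ∫ z in (0:ℝ)..0.002, ffJ7 j (0.002 + z) :=
    integral_sub2 (by fun_prop) (by fun_prop)
  rw [d6pJ_eq, hd6, lowInt1214, midInt1214, topInt1214, midInt1214_pieces, topInt1214_pieces,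
    hprod, hαinv]
  unfold d6pF d6F
  rw [D7]
  push_cast
  rw [hα]
  generalize (∫ z in (0:ℝ)..0.002, ffJ6 j z) = A1
  generalize (∫ z in (0:ℝ)..0.002, ffJ7 j (0.002 + z)) = A2
  generalize (∫ z in (0 : ℝ)..0.002,
      (conj iota3 * ffJ6 j z / 0.498 + conj iota4 * ffJ7 j (0.002 + z) / 0.5) *
        yyJ1 j (0.502 - z)) = A3
  generalize (∫ z in (0:ℝ)..0.002, ffJ7 j z) = A4
  generalize (∫ z in (0:ℝ)..0.002, ffJ7 j z * yyJ2 j (0.504 - z)) = A5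
  generalize (∫ z in (0 : ℝ)..0.496,
      (conj iota3 * ffJ6 j (0.002 + z) / 0.498 + conj iota4 * ffJ7 j (0.004 + z) / 0.5)) = B1
  field_simp
  ring

end D34Gather1214

section D34Gather1214b

/-- **The low-range mismatch is `o(1)`**: for every `δ > 0`, for all large `D` and every primitive
`χ (mod D)`, `‖α⁻¹(lowInt1214 + midInt1214 + topInt1214) − (d′_{6j} + d_{6j})𝔞‖ ≤ δ` (`j = 1, 2, 3`)
— by `gather1214_identity` the left side is `(n_jπ/500)·𝔞·|E_j|·‖B₁‖` with `𝔞 ≤ (96e⁹/π²)𝓛⁴`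
(`Skeleton.frakA_le_ell_pow_four`), `|E_j| ≤ 6|c′|π𝓛⁻⁸ + 5c′²π²𝓛⁻¹⁶` and `B₁` independent of `D`,
i.e. `≪_{c′} 𝓛⁻⁴`. This is where "`β_{j+1}β_{j+2}log P = −(11−6j+j²)πα + o(α)`" (p. 58) and the
tacit `𝔞 ≪ 𝓛⁴` enter. [cite: Zhang2022LandauSiegel, §10 p. 61] -/
theorem gather1214_main_small (c' : ℝ) : ∀ δ : ℝ, 0 < δ → ForAllLarge fun D _ χ =>
    ∀ j ∈ ({1, 2, 3} : Finset ℕ),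
      ‖(alpha D : ℂ)⁻¹ * (lowInt1214 c' χ j + midInt1214 χ j + topInt1214 χ j) -
          (d6pJ j + d6J j) * frakA χ‖ ≤ δ := by
  intro δ hδ
  -- the `D`-independent integrals `B₁(j)`, `j = 1, 2, 3`, and a common bound `M`
  set B : ℕ → ℂ := fun j => ∫ z in (0 : ℝ)..0.496,
    (conj iota3 * ffJ6 j (0.002 + z) / 0.498 + conj iota4 * ffJ7 j (0.004 + z) / 0.5) with hB
  set M : ℝ := ‖B 1‖ + ‖B 2‖ + ‖B 3‖ with hM
  have hM0 : 0 ≤ M := by positivity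
  have hBM : ∀ j ∈ ({1, 2, 3} : Finset ℕ), ‖B j‖ ≤ M := by
    intro j hj
    simp only [Finset.mem_insert, Finset.mem_singleton] at hj
    have h1 := norm_nonneg (B 1); have h2 := norm_nonneg (B 2); have h3 := norm_nonneg (B 3)
    rcases hj with rfl | rfl | rfl <;> linarith
  -- the constant `C` with error `≤ C·𝓛⁻⁴`
  -- `𝔞 ≤ K𝓛⁴` (the tree's `Skeleton.frakA_le_ell_pow_four`; `K` by unification)
  obtain ⟨K, hK0, hAK⟩ : ∃ K : ℝ, 0 ≤ K ∧ ∀ (D : ℕ) [NeZero D] (χ : DirichletCharacter ℂ D),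
      3 ≤ ell D → χ.IsPrimitive → frakA χ ≤ K * ell D ^ 4 :=
    ⟨_, by positivity, fun D _ χ h hp => frakA_le_ell_pow_four χ h hp⟩
  set C : ℝ := 6 * π / 500 * K * M * (6 * |c'| * π + 5 * c' ^ 2 * π ^ 2) + 1 with hC
  have hC1 : 1 ≤ C := by
    have : 0 ≤ 6 * π / 500 * K * M * (6 * |c'| * π + 5 * c' ^ 2 * π ^ 2) := by positivity
    linarith
  have hC0 : 0 < C := by linarith
  refine ⟨max 21 ⌈Real.exp (C / δ + 1)⌉₊, fun D _ χ hD _ hp j hj => ?_⟩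
  have hD21 : 21 ≤ D := le_trans (le_max_left _ _) hD
  have hDexp : Real.exp (C / δ + 1) ≤ D :=
    le_trans (Nat.le_ceil _) (by exact_mod_cast le_trans (le_max_right _ _) hD)
  have hℓ3 : 3 < ell D := three_lt_log_of_le hD21
  have hℓ0 : 0 < ell D := by linarith
  have hℓ1 : 1 ≤ ell D := by linarith
  have hℓC : C / δ + 1 ≤ ell D := by
    rw [ell]
    exact (Real.le_log_iff_exp_le (by positivity)).mpr hDexp
  have hΛ : 0 < Real.log (bigP D) := by rw [bigP, Real.log_exp]; positivity
  obtain ⟨n, E, hn, hE, hid⟩ := gather1214_identity c' χ hj hΛ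
  rw [hid]
  have hA0 : 0 ≤ frakA χ := frakA_nonneg χ
  have hA : frakA χ ≤ K * ell D ^ 4 := hAK D χ hℓ3.le hp
  have hu : c' * alpha D * ell D = c' * π / ell D ^ 8 := by
    rw [mul_assoc, alpha_mul_ell hℓ0]; ring
  -- `|E| ≤ 6|c'|π𝓛⁻⁸ + 5c'²π²𝓛⁻¹⁶ ≤ (6|c'|π + 5c'²π²)·𝓛⁻⁸`
  have hE' : |E| ≤ (6 * |c'| * π + 5 * c' ^ 2 * π ^ 2) * (ell D ^ 8)⁻¹ := by
    refine hE.trans ?_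
    rw [hu, abs_div, abs_mul, abs_of_pos Real.pi_pos, abs_of_pos (by positivity : 0 < ell D ^ 8)]
    have h8 : 1 ≤ ell D ^ 8 := one_le_pow₀ hℓ1
    have hi : 0 < (ell D ^ 8)⁻¹ := by positivity
    have hle : (ell D ^ 8)⁻¹ ≤ 1 := inv_le_one_of_one_le₀ h8
    have hsq : (c' * π / ell D ^ 8) ^ 2 = c' ^ 2 * π ^ 2 * (ell D ^ 8)⁻¹ * (ell D ^ 8)⁻¹ := by
      field_simp
    rw [hsq, div_eq_mul_inv]
    have hc : 0 ≤ c' ^ 2 * π ^ 2 * (ell D ^ 8)⁻¹ := by positivity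
    nlinarith [abs_nonneg c']
  -- the norm of the error term
  have hnorm : ‖-((((n : ℝ) * π / 500 : ℝ)) : ℂ) * (frakA χ : ℂ) * (E : ℂ) * B j‖ =
      (n : ℝ) * π / 500 * frakA χ * |E| * ‖B j‖ := by
    rw [norm_mul, norm_mul, norm_mul, norm_neg, Complex.norm_real, Complex.norm_real,
      Complex.norm_real, Real.norm_of_nonneg (by positivity), Real.norm_of_nonneg hA0,
      Real.norm_eq_abs]
  rw [hnorm]
  have hn6 : (n : ℝ) * π / 500 ≤ 6 * π / 500 := by gcongr
  calc (n : ℝ) * π / 500 * frakA χ * |E| * ‖B j‖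
      ≤ 6 * π / 500 * (K * ell D ^ 4) * ((6 * |c'| * π + 5 * c' ^ 2 * π ^ 2) * (ell D ^ 8)⁻¹) *
          M := by gcongr; exact hBM j hj
    _ = 6 * π / 500 * K * M * (6 * |c'| * π + 5 * c' ^ 2 * π ^ 2) * (ell D ^ 4)⁻¹ := by
        field_simp
    _ ≤ C * (ell D ^ 4)⁻¹ := by gcongr; linarith
    _ ≤ C * (ell D)⁻¹ := by
        gcongr
        calc ell D = ell D ^ 1 := (pow_one _).symm
          _ ≤ ell D ^ 4 := pow_le_pow_right₀ hℓ1 (by norm_num)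
    _ ≤ δ := by
        rw [mul_inv_le_iff₀ hℓ0]
        have : C / δ ≤ ell D := by linarith
        rw [div_le_iff₀ hδ] at this
        linarith

/-- Norm of an eight-term sum. [folklore] -/
private theorem norm_add8_le (a b c d e f g h : ℂ) :
    ‖a + b + c + d + e + f + g + h‖ ≤ ‖a‖ + ‖b‖ + ‖c‖ + ‖d‖ + ‖e‖ + ‖f‖ + ‖g‖ + ‖h‖ := by
  calc ‖a + b + c + d + e + f + g + h‖ ≤ ‖a + b + c + d + e + f + g‖ + ‖h‖ := norm_add_le _ _
    _ ≤ ‖a + b + c + d + e + f‖ + ‖g‖ + ‖h‖ := by gcongr; exact norm_add_le _ _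
    _ ≤ ‖a + b + c + d + e‖ + ‖f‖ + ‖g‖ + ‖h‖ := by gcongr; exact norm_add_le _ _
    _ ≤ ‖a + b + c + d‖ + ‖e‖ + ‖f‖ + ‖g‖ + ‖h‖ := by gcongr; exact norm_add_le _ _
    _ ≤ ‖a + b + c‖ + ‖d‖ + ‖e‖ + ‖f‖ + ‖g‖ + ‖h‖ := by gcongr; exact norm_add_le _ _
    _ ≤ ‖a + b‖ + ‖c‖ + ‖d‖ + ‖e‖ + ‖f‖ + ‖g‖ + ‖h‖ := by gcongr; exact norm_add_le _ _
    _ ≤ ‖a‖ + ‖b‖ + ‖c‖ + ‖d‖ + ‖e‖ + ‖f‖ + ‖g‖ + ‖h‖ := by gcongr; exact norm_add_le _ _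

/-- **Z22:§10.u058 as a kernel EDGE** [Z22 p.61, tex L3111]: "Gathering the above results together we
conclude `α⁻¹S_j(𝐚₁₂,𝐚₁₄) = (d′_{6j} + d_{6j})𝔞 + o(1)`" — PROVED from the seven range claims of
p. 60–61 (`Low1214Eval`, `Low1214X`, `Low1214Int`, `Mid1214Eval`, `Mid1214Int`, `Top1214Eval`,
`Top1214Int`), via the expansion (u054), the split (u055) and `gather1214_main_small` (the exact
identity up to the `o(1)` from `β_{j+1}β_{j+2}log P = −(11−6j+j²)πα + o(α)` and `𝔞 ≪ 𝓛⁴`). The range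
claims themselves remain CLAIM nodes. [cite: Zhang2022LandauSiegel, §10 p. 61] -/
theorem gather1214_of_ranges (c' : ℝ) (hLowE : Low1214Eval c') (hLowX : Low1214X c')
    (hLowI : Low1214Int c') (hMidE : Mid1214Eval c') (hMidI : Mid1214Int c')
    (hTopE : Top1214Eval c') (hTopI : Top1214Int c') : Gather1214 c' := by
  intro ε hε
  have hε8 : 0 < ε / 8 := by positivity
  have H := ((((((((((sjExpand1214_holds c').and (split1214_holds c')).and (hLowE _ hε8)).and
    (hLowX _ hε8)).and (hLowI _ hε8)).and (hMidE _ hε8)).and (hMidI _ hε8)).and (hTopE _ hε8)).and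
    (hTopI _ hε8)).and forAllLarge_log_bigP_pos).and (gather1214_main_small c' _ hε8)
  refine H.mono fun D _ χ _ _ h hA j hj => ?_
  obtain ⟨⟨⟨⟨⟨⟨⟨⟨⟨⟨e1, e2⟩, e3⟩, e4⟩, e5⟩, e6⟩, e7⟩, e8⟩, e9⟩, hΛ⟩, e10⟩ := h
  have hα := alpha_pos hΛ
  have key : (alpha D : ℂ)⁻¹ * Sj c' D j (a12 χ) (a14 χ) - (d6pJ j + d6J j) * frakA χ =
      (alpha D : ℂ)⁻¹ * (S1214On c' χ j 0 (bigP D ^ (0.496 : ℝ)) - lowSum1214 c' χ j) +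
      (alpha D : ℂ)⁻¹ * (lowSum1214 c' χ j - lowX1214 c' χ j) +
      (alpha D : ℂ)⁻¹ * (lowX1214 c' χ j - lowInt1214 c' χ j) +
      (alpha D : ℂ)⁻¹ *
        (S1214On c' χ j (bigP D ^ (0.496 : ℝ)) (bigP D ^ (0.498 : ℝ)) - midSum1214 c' χ j) +
      (alpha D : ℂ)⁻¹ * (midSum1214 c' χ j - midInt1214 χ j) +
      (alpha D : ℂ)⁻¹ *
        (S1214On c' χ j (bigP D ^ (0.498 : ℝ)) (bigP D ^ (0.5 : ℝ)) - topSum1214 c' χ j) +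
      (alpha D : ℂ)⁻¹ * (topSum1214 c' χ j - topInt1214 χ j) +
      ((alpha D : ℂ)⁻¹ * (lowInt1214 c' χ j + midInt1214 χ j + topInt1214 χ j) -
        (d6pJ j + d6J j) * frakA χ) := by
    rw [e1 hA j hj, e2 hA j hj]; ring
  rw [key]
  refine (norm_add8_le _ _ _ _ _ _ _ _).trans ?_
  simp only [norm_mul, norm_inv_alpha hΛ]
  have b3 := e3 hA j hj; have b4 := e4 hA j hj; have b5 := e5 hA j hj; have b6 := e6 hA j hj
  have b7 := e7 hA j hj; have b8 := e8 hA j hj; have b9 := e9 hA j hj; have b10 := e10 j hj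
  have hi : ∀ x : ℝ, x ≤ ε / 8 * alpha D → (alpha D)⁻¹ * x ≤ ε / 8 := fun x hx => by
    calc (alpha D)⁻¹ * x ≤ (alpha D)⁻¹ * (ε / 8 * alpha D) :=
          mul_le_mul_of_nonneg_left hx (inv_nonneg.mpr hα.le)
      _ = ε / 8 := by field_simp
  linarith [hi _ b3, hi _ b4, hi _ b5, hi _ b6, hi _ b7, hi _ b8, hi _ b9]

end D34Gather1214b

end Literature.NumberTheory.LFunctions.Zhang2022.Typed.Sec10C
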